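/-
HONEST FRAMING: certified error envelopes and provably optimal rounding/accumulation schemes for
low-precision formats under stated cost models; every table by two implementations; no hardware
or vendor claims.
-/
import Summits.Ventures.CertifiedArithmetic.LowPrec.OptDemotionRoutingR17

/-!
# The demotion law (Theorem T8), part 8g: TRANSPLANTING a bit family (opt gen 13 §4, "value independence" for the (M)/(MC) surgeries)

For the weighted routing value `treeBRw` of part 8a.  opt's monotonicity (M) and midpoint-convexity
(MC) surgeries (gen13/README §4) move one original bit `b` of a routable base configuration `S₀` to
a new position `b + d ∉ S₀` that has THE SAME ORDER RELATIONS to the other bits, and let the whole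
family of `b` (its iterated injections `b - kq`) follow: `transplant q b d` shifts the residue
class of `b` by `d` and fixes everything else.  THIS FILE proves that every routing survives the
move (`treeBRw_le_transplant`): for weights `W, W'` with `W x ≤ W' (transplant x)` on the exponents
reachable from `S₀`, `treeBRw q W t C ≤ treeBRw q W' t (C.image transplant)` for every
configuration `C` reachable from `S₀` — the one instance of value independence (R17(b1)) that the
surgeries use.  Ingredients: on the reachable exponents the transplant is strictly increasing
(`transplant_lt_iff`) and preserves routability (`routable_image_transplant`), by the arithmetic of
`e - kq` versus `e' - k'q` for bits `e, e'` less than `q` apart (`shift_lt_iff`, `shift_dist`).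
-/

namespace Summit.Ventures.CertifiedArithmetic.LowPrec.Opt

open Literature.ComputerArithmetic.JeannerodRump2018
open Literature.ComputerArithmetic.JeannerodRump2018.SumTree

/-! ## Arithmetic of shifted bits -/

/-- Two bits `a, a'` on the same side of `e` and less than `q` away from it compare with the
injections of `e` in the same way: `a - kq < e - k'q ↔ a' - kq < e - k'q`. -/
theorem shift_lt_iff {q : ℕ} {a a' e : ℤ} (ha : |a - e| ≤ (q : ℤ) - 1) (ha' : |a' - e| ≤ (q : ℤ) - 1)
    (hord : a < e ↔ a' < e) (k k' : ℕ) :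
    a - k * q < e - k' * q ↔ a' - k * q < e - k' * q := by
  rw [abs_le] at ha ha'
  have hmq : ∀ m : ℕ, (0 : ℤ) ≤ (m : ℤ) * q := fun m => by positivity
  rcases lt_trichotomy k k' with h | rfl | h
  · -- k < k': both sides are false
    obtain ⟨m, rfl⟩ : ∃ m, k' = k + 1 + m := ⟨k' - k - 1, by omega⟩
    push_cast
    have := hmq m
    constructor <;> intro hlt <;> exfalso <;> nlinarith
  · simp only [sub_lt_sub_iff_right]; exact hord
  · -- k > k': both sides are true
    obtain ⟨m, rfl⟩ : ∃ m, k = k' + 1 + m := ⟨k - k' - 1, by omega⟩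
    push_cast
    have := hmq m
    constructor <;> intro _ <;> nlinarith

/-- … and the reverse comparison. -/
theorem shift_gt_iff {q : ℕ} {a a' e : ℤ} (ha : |a - e| ≤ (q : ℤ) - 1) (ha' : |a' - e| ≤ (q : ℤ) - 1)
    (hne : a ≠ e) (hne' : a' ≠ e) (hord : a < e ↔ a' < e) (k k' : ℕ) :
    e - k' * q < a - k * q ↔ e - k' * q < a' - k * q := by
  rw [abs_le] at ha ha'
  have hord' : e < a ↔ e < a' := by
    constructor
    · intro h; by_contra h'; exact absurd (hord.2 (lt_of_le_of_ne (not_lt.1 h') hne')) (by linarith)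
    · intro h; by_contra h'; exact absurd (hord.1 (lt_of_le_of_ne (not_lt.1 h') hne)) (by linarith)
  have hmq : ∀ m : ℕ, (0 : ℤ) ≤ (m : ℤ) * q := fun m => by positivity
  rcases lt_trichotomy k k' with h | rfl | h
  · obtain ⟨m, rfl⟩ : ∃ m, k' = k + 1 + m := ⟨k' - k - 1, by omega⟩
    push_cast
    have := hmq m
    constructor <;> intro _ <;> nlinarith
  · simp only [sub_lt_sub_iff_right]; exact hord'
  · obtain ⟨m, rfl⟩ : ∃ m, k = k' + 1 + m := ⟨k - k' - 1, by omega⟩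
    push_cast
    have := hmq m
    constructor <;> intro hlt <;> exfalso <;> nlinarith

/-- … and they stay within `q - 1` of the injections of `e` together. -/
theorem shift_dist {q : ℕ} {a a' e : ℤ} (ha : |a - e| ≤ (q : ℤ) - 1) (ha' : |a' - e| ≤ (q : ℤ) - 1)
    (hne : a ≠ e) (hne' : a' ≠ e) (hord : a < e ↔ a' < e) (k k' : ℕ)
    (h : |(a - k * q) - (e - k' * q)| ≤ (q : ℤ) - 1) : |(a' - k * q) - (e - k' * q)| ≤ (q : ℤ) - 1 := by
  rw [abs_le] at ha ha' h ⊢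
  have hord' : e < a ↔ e < a' := by
    constructor
    · intro h; by_contra h'; exact absurd (hord.2 (lt_of_le_of_ne (not_lt.1 h') hne')) (by linarith)
    · intro h; by_contra h'; exact absurd (hord.1 (lt_of_le_of_ne (not_lt.1 h') hne)) (by linarith)
  -- `m ≥ 1` copies of `q` do not fit
  have hbig : ∀ m : ℕ, 0 < m → (q : ℤ) ≤ (m : ℤ) * q := fun m hm => by
    have h1 : (1 : ℤ) ≤ m := by exact_mod_cast hm
    have hq : (0 : ℤ) ≤ q := by positivity
    nlinarith
  rcases lt_trichotomy k k' with hk | rfl | hk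
  · obtain ⟨m, rfl⟩ : ∃ m, k' = k + 1 + m := ⟨k' - k - 1, by omega⟩
    push_cast at h ⊢
    rcases Nat.eq_zero_or_pos m with rfl | hm
    · push_cast at h ⊢
      have hae : a < e := by linarith
      have := hord.1 hae
      constructor <;> linarith
    · have := hbig m hm
      exfalso; linarith
  · constructor <;> linarith
  · obtain ⟨m, rfl⟩ : ∃ m, k = k' + 1 + m := ⟨k - k' - 1, by omega⟩
    push_cast at h ⊢
    rcases Nat.eq_zero_or_pos m with rfl | hm
    · push_cast at h ⊢
      have hea : e < a := by linarith
      have := hord'.1 hea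
      constructor <;> linarith
    · have := hbig m hm
      exfalso; linarith

/-! ## The transplant map on the exponents reachable from a base configuration -/

/-- The exponents reachable from the base configuration `S₀` by injections. -/
def InD (q : ℕ) (S₀ : Finset ℤ) (x : ℤ) : Prop := ∃ e ∈ S₀, ∃ k : ℕ, x = e - k * q

/-- `S₀` itself is reachable. -/
theorem inD_of_mem {q : ℕ} {S₀ : Finset ℤ} {e : ℤ} (he : e ∈ S₀) : InD q S₀ e :=
  ⟨e, he, 0, by simp⟩

/-- Reachability is closed under injection. -/
theorem inD_sub {q : ℕ} {S₀ : Finset ℤ} {x : ℤ} (h : InD q S₀ x) : InD q S₀ (x - q) := by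
  obtain ⟨e, he, k, rfl⟩ := h
  exact ⟨e, he, k + 1, by push_cast; ring⟩

/-- THE TRANSPLANT: shift the residue class of `b` by `d`, fix the rest. -/
def transplant (q : ℕ) (b d : ℤ) (x : ℤ) : ℤ := if (q : ℤ) ∣ x - b then x + d else x

/-- The transplant commutes with injection. -/
theorem transplant_sub (q : ℕ) (b d x : ℤ) : transplant q b d (x - q) = transplant q b d x - q := by
  unfold transplant
  by_cases h : (q : ℤ) ∣ x - b
  · rw [if_pos ((dvd_sub_shift_iff _ _ _).2 h), if_pos h]; ring
  · rw [if_neg (fun h' => h ((dvd_sub_shift_iff _ _ _).1 h')), if_neg h]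

section Transplant

variable {q : ℕ} {S₀ : Finset ℤ} {b d : ℤ}

/-- The setting of a transplant: `S₀` routable, `b ∈ S₀`, the new position `b + d` outside `S₀`,
the new base configuration routable, and `b + d` on the same side of every other bit as `b`. -/
structure TransplantOK (q : ℕ) (S₀ : Finset ℤ) (b d : ℤ) : Prop where
  /-- the base configuration is routable -/
  base : Routable q S₀
  /-- the moved bit -/
  mem : b ∈ S₀
  /-- the new position is free -/
  new : b + d ∉ S₀
  /-- the new base configuration is routable -/
  base' : Routable q (insert (b + d) (S₀.erase b))
  /-- the order relations are kept -/
  order : ∀ e ∈ S₀, e ≠ b → (b < e ↔ b + d < e)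

/-- A reachable exponent in the class of `b` is an injection of `b`. -/
theorem TransplantOK.eq_of_dvd (h : TransplantOK q S₀ b d) {x : ℤ} (hx : InD q S₀ x)
    (hdvd : (q : ℤ) ∣ x - b) : ∃ k : ℕ, x = b - k * q := by
  obtain ⟨e, he, k, rfl⟩ := hx
  refine ⟨k, ?_⟩
  have : (q : ℤ) ∣ e - b := by
    have := dvd_add hdvd (dvd_mul_left (q : ℤ) (k : ℤ))
    rwa [show e - k * q - b + k * q = e - b by ring] at this
  rw [eq_of_routable_of_dvd h.base he h.mem this]

/-- A reachable exponent outside the class of `b` is an injection of another bit of `S₀`. -/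
theorem TransplantOK.eq_of_not_dvd (h : TransplantOK q S₀ b d) {x : ℤ} (hx : InD q S₀ x)
    (hdvd : ¬ (q : ℤ) ∣ x - b) : ∃ e ∈ S₀, e ≠ b ∧ ∃ k : ℕ, x = e - k * q := by
  obtain ⟨e, he, k, rfl⟩ := hx
  refine ⟨e, he, ?_, k, rfl⟩
  rintro rfl
  exact hdvd ⟨-(k : ℤ), by ring⟩

/-- The facts about a bit `e ≠ b` of `S₀` used below. -/
theorem TransplantOK.facts (h : TransplantOK q S₀ b d) {e : ℤ} (he : e ∈ S₀) (hne : e ≠ b) :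
    |b - e| ≤ (q : ℤ) - 1 ∧ |b + d - e| ≤ (q : ℤ) - 1 ∧ b ≠ e ∧ b + d ≠ e ∧ (b < e ↔ b + d < e) := by
  have h1 := h.base b h.mem e he
  have h2 := h.base e he b h.mem
  have he' : e ∈ insert (b + d) (S₀.erase b) := Finset.mem_insert_of_mem (Finset.mem_erase.2 ⟨hne, he⟩)
  have hb' : b + d ∈ insert (b + d) (S₀.erase b) := Finset.mem_insert_self _ _
  have h3 := h.base' _ hb' e he'
  have h4 := h.base' e he' _ hb'
  exact ⟨abs_le.2 ⟨by linarith, by linarith⟩, abs_le.2 ⟨by linarith, by linarith⟩, fun h' => hne h'.symm,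
    fun h' => h.new (h' ▸ he), h.order e he hne⟩

end Transplant


section Transplant2

variable {q : ℕ} {S₀ : Finset ℤ} {b d : ℤ}

/-- THE TRANSPLANT IS STRICTLY INCREASING on the reachable exponents. -/
theorem TransplantOK.lt_iff (h : TransplantOK q S₀ b d) {x y : ℤ} (hx : InD q S₀ x) (hy : InD q S₀ y) :
    transplant q b d x < transplant q b d y ↔ x < y := by
  unfold transplant
  by_cases hxb : (q : ℤ) ∣ x - b <;> by_cases hyb : (q : ℤ) ∣ y - b
  · rw [if_pos hxb, if_pos hyb]; constructor <;> intro _ <;> linarith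
  · rw [if_pos hxb, if_neg hyb]
    obtain ⟨k, rfl⟩ := h.eq_of_dvd hx hxb
    obtain ⟨e, he, hne, k', rfl⟩ := h.eq_of_not_dvd hy hyb
    obtain ⟨h1, h2, -, -, h5⟩ := h.facts he hne
    have := shift_lt_iff (q := q) h1 h2 h5 k k'
    rw [show b - k * q + d = b + d - k * q by ring]
    exact this.symm
  · rw [if_neg hxb, if_pos hyb]
    obtain ⟨k', rfl⟩ := h.eq_of_dvd hy hyb
    obtain ⟨e, he, hne, k, rfl⟩ := h.eq_of_not_dvd hx hxb
    obtain ⟨h1, h2, h3, h4, h5⟩ := h.facts he hne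
    have := shift_gt_iff (q := q) h1 h2 h3 h4 h5 k' k
    rw [show b - k' * q + d = b + d - k' * q by ring]
    exact this.symm
  · rw [if_neg hxb, if_neg hyb]

/-- … hence monotone … -/
theorem TransplantOK.le_of_le (h : TransplantOK q S₀ b d) {x y : ℤ} (hx : InD q S₀ x) (hy : InD q S₀ y)
    (hxy : x ≤ y) : transplant q b d x ≤ transplant q b d y := by
  rcases eq_or_lt_of_le hxy with rfl | hlt
  · exact le_rfl
  · exact ((h.lt_iff hx hy).2 hlt).le

/-- … and injective there. -/
theorem TransplantOK.injOn (h : TransplantOK q S₀ b d) {C : Finset ℤ} (hC : ∀ x ∈ C, InD q S₀ x) :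
    Set.InjOn (transplant q b d) C := by
  intro x hx y hy hxy
  rcases lt_trichotomy x y with hlt | heq | hgt
  · exact absurd hxy (ne_of_lt ((h.lt_iff (hC x hx) (hC y hy)).2 hlt))
  · exact heq
  · exact absurd hxy.symm (ne_of_lt ((h.lt_iff (hC y hy) (hC x hx)).2 hgt))

/-- THE TRANSPLANT PRESERVES ROUTABILITY of reachable configurations. -/
theorem TransplantOK.routable_image (h : TransplantOK q S₀ b d) {C : Finset ℤ}
    (hC : ∀ x ∈ C, InD q S₀ x) (hr : Routable q C) : Routable q (C.image (transplant q b d)) := by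
  intro x' hx' y' hy'
  obtain ⟨x, hx, rfl⟩ := Finset.mem_image.1 hx'
  obtain ⟨y, hy, rfl⟩ := Finset.mem_image.1 hy'
  have hxy := hr x hx y hy
  have hyx := hr y hy x hx
  unfold transplant
  by_cases hxb : (q : ℤ) ∣ x - b <;> by_cases hyb : (q : ℤ) ∣ y - b
  · rw [if_pos hxb, if_pos hyb]; linarith
  · rw [if_pos hxb, if_neg hyb]
    obtain ⟨k, rfl⟩ := h.eq_of_dvd (hC x hx) hxb
    obtain ⟨e, he, hne, k', rfl⟩ := h.eq_of_not_dvd (hC y hy) hyb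
    obtain ⟨h1, h2, h3, h4, h5⟩ := h.facts he hne
    have habs : |(b - k * q) - (e - k' * q)| ≤ (q : ℤ) - 1 := abs_le.2 ⟨by linarith, by linarith⟩
    have := abs_le.1 (shift_dist h1 h2 h3 h4 h5 k k' habs)
    linarith [this.2]
  · rw [if_neg hxb, if_pos hyb]
    obtain ⟨k', rfl⟩ := h.eq_of_dvd (hC y hy) hyb
    obtain ⟨e, he, hne, k, rfl⟩ := h.eq_of_not_dvd (hC x hx) hxb
    obtain ⟨h1, h2, h3, h4, h5⟩ := h.facts he hne
    have habs : |(b - k' * q) - (e - k * q)| ≤ (q : ℤ) - 1 := abs_le.2 ⟨by linarith, by linarith⟩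
    have := abs_le.1 (shift_dist h1 h2 h3 h4 h5 k' k habs)
    linarith [this.1]
  · rw [if_neg hxb, if_neg hyb]; linarith

/-- The top of the image is the image of the top. -/
theorem TransplantOK.max'_image (h : TransplantOK q S₀ b d) {C : Finset ℤ} (hC : ∀ x ∈ C, InD q S₀ x)
    (hne : C.Nonempty) (hne' : (C.image (transplant q b d)).Nonempty) :
    (C.image (transplant q b d)).max' hne' = transplant q b d (C.max' hne) := by
  refine le_antisymm (Finset.max'_le _ hne' _ fun y hy => ?_)
    (Finset.le_max' _ _ (Finset.mem_image_of_mem _ (Finset.max'_mem C hne)))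
  obtain ⟨x, hx, rfl⟩ := Finset.mem_image.1 hy
  exact h.le_of_le (hC x hx) (hC _ (Finset.max'_mem C hne)) (Finset.le_max' C x hx)

/-- **EVERY ROUTING SURVIVES THE TRANSPLANT** (value independence for the (M)/(MC) surgeries):
for weights `W, W'` with `W x ≤ W' (transplant x)` on the exponents reachable from `S₀`, the
routing value of a reachable routable configuration at `W` is at most that of its transplant at
`W'`. -/
theorem treeBRw_le_transplant (h : TransplantOK q S₀ b d) {W W' : ℤ → ℚ}
    (hWW : ∀ x, InD q S₀ x → W x ≤ W' (transplant q b d x)) :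
    ∀ (t : SumTree) (C : Finset ℤ), (∀ x ∈ C, InD q S₀ x) → Routable q C →
      treeBRw q W t C ≤ treeBRw q W' t (C.image (transplant q b d))
  | .leaf _, C, _, _ => by simp
  | .node l r, C, hC, hr => by
      by_cases hne : C.Nonempty
      · have hne' : (C.image (transplant q b d)).Nonempty := hne.image _
        have htop := h.max'_image hC hne hne'
        have hins : ∀ x ∈ insert (C.max' hne - q) C, InD q S₀ x := by
          intro x hx
          rcases Finset.mem_insert.1 hx with rfl | hx
          · exact inD_sub (hC _ (Finset.max'_mem C hne))
          · exact hC x hx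
        have hw := hWW _ (hC _ (Finset.max'_mem C hne))
        have hfold := fold_max_nonneg (splits q (C.image (transplant q b d)) ((C.image (transplant q b d)).max' hne'))
          (fun AB => treeBRw q W' l AB.1 + treeBRw q W' r AB.2)
        rcases treeBRw_node_eq (q := q) (W := W) (a := l) (b := r) hne with h0 | ⟨AB, hAB, hval⟩
        · rw [h0, treeBRw_node q W' l r hne', htop]
          rw [htop] at hfold
          linarith
        · rw [hval]
          obtain ⟨hA, hB, -, -, hrA, hrB⟩ := of_mem_splits (A := AB.1) (B := AB.2) hAB
          have hAi : ∀ x ∈ AB.1, InD q S₀ x := fun x hx => hins x (hA hx)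
          have hBi : ∀ x ∈ AB.2, InD q S₀ x := fun x hx => hins x (hB hx)
          have iha := treeBRw_le_transplant h hWW l AB.1 hAi hrA
          have ihb := treeBRw_le_transplant h hWW r AB.2 hBi hrB
          have hmem : (AB.1.image (transplant q b d), AB.2.image (transplant q b d)) ∈
              splits q (C.image (transplant q b d)) ((C.image (transplant q b d)).max' hne') := by
            rw [htop]
            obtain ⟨h1, -, -⟩ := mem_splits.1 hAB
            refine mem_splits.2 ⟨?_, h.routable_image hAi hrA, h.routable_image hBi hrB⟩
            rcases h1 with ⟨hs, hB'⟩ | ⟨hs, hB'⟩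
            · left
              refine ⟨Finset.image_subset_image hs, ?_⟩
              rw [hB', Finset.image_sdiff_of_injOn (h.injOn hC) hs]
            · right
              have e1 : (insert (C.max' hne - (q : ℤ)) C).image (transplant q b d) =
                  insert (transplant q b d (C.max' hne) - (q : ℤ)) (C.image (transplant q b d)) := by
                rw [Finset.image_insert, transplant_sub]
              refine ⟨?_, ?_⟩
              · rw [← e1]; exact Finset.image_subset_image hs
              · rw [hB', Finset.image_sdiff_of_injOn (h.injOn hins) hs, e1]
          have hs := split_le_treeBRw_node (q := q) (W := W') (a := l) (b := r) hne' hmem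
          rw [htop] at hs
          linarith
      · rw [Finset.not_nonempty_iff_eq_empty.1 hne]; simp

end Transplant2

end Summit.Ventures.CertifiedArithmetic.LowPrec.Opt
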